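import Literature.NumberTheory.GaloisRepresentations.WeakAbelianDirectSummand
import Literature.NumberTheory.GaloisRepresentations.CyclotomicCharacterFrobeniusProofs
import Literature.NumberTheory.GaloisRepresentations.ArtinCharacterReciprocity
import Literature.NumberTheory.GaloisRepresentations.HeckeLFunctionNonvanishingLineProofs
import Literature.NumberTheory.GaloisRepresentations.IntegralGaloisActionProofs
import HarnessLib

/-!
# Weak abelian direct summands (Böckle–Hui 2025, Thm. 1.1): the cyclotomic witness, proved

Topic `NumberTheory/GaloisRepresentations`; namespace
`Literature.NumberTheory.GaloisRepresentations`.  A *proofs* file (theorems only; no definition,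
no named fact), sibling of `WeakAbelianDirectSummand.lean` (the named fact
`exists_heckeCharacter_of_weaklyDivides`, Böckle–Hui Thm. 1.1 in the Hecke-character form of
BH §3.2.1) and of `WeakAbelianDirectSummandProofs.lean` (the finite-image case).

The module docstring of `WeakAbelianDirectSummand.lean` fixes the normalisation of the fact —
`ψ(Frob_v^{arith}) = ι⁻¹(χ(ϖ_v))⁻¹` for an ALGEBRAIC Hecke character `χ` — and checks it by hand
on the `ℓ`-adic cyclotomic character: "`χ_ℓ(Frob_v) = q_v`, and `χ = ‖·‖` works:
`χ(ϖ_v) = q_v⁻¹`".  This file PROVES that check, i.e. certifies formally that the conclusion of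
the fact is satisfied, with the stated signs, by the basic locally algebraic character of
infinite order:

* `HeckeCharacter.isAlgebraic_normCharacter` — **the norm character `‖·‖ : 𝕀_K/Kˣ → ℂˣ` is
  algebraic** (type `A₀`): on the neighbourhood of `1` in `(K ⊗ ℝ)ˣ` where the real coordinates
  are positive, `‖x‖ = ∏_{w real} ι_w(x_w) · ∏_{w complex} ι_w(x_w) \overline{ι_w(x_w)}`, i.e.
  `p_w = -1` for all `w` and `q_w = 0` (real `w`), `q_w = -1` (complex `w`) in
  `HeckeCharacter.IsAlgebraic` (Weil 1956: `‖·‖` is of type `A₀`; Serre 1968, Ch. II §2.3–2.4).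
  This is the first non-finite-order inhabitant of `HeckeCharacter.IsAlgebraic` in the tree.
* `HeckeCharacter.isUnramifiedAt_normCharacter`, `HeckeCharacter.valueAtUniformizer_normCharacter`
  — `‖·‖` is unramified at every finite `v` with `‖ϖ_v‖ = (N v)⁻¹` (Tate 1950 §2.3, §4.3; from the
  tree's `IsNormTwist.isUnramifiedAt_holds`, `ideleNorm_localUnits`, `norm_uniformizer`).
* `FramedGaloisRep.hasFrobCharpolyAt_normCharacter_of_cyclotomic` — for every rank-one
  `ψ : Γ_K →ₜ* GL_1(ℚ̄_ℓ)` whose matrix entry is the `ℓ`-adic cyclotomic character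
  (`(ψ σ)₀₀ = χ_ℓ(σ)` in `ℚ̄_ℓ`) and every field isomorphism `ι : ℚ̄_ℓ ≃+* ℂ`: at every `v ∤ ℓ`,
  `ψ` is unramified and `ψ.HasFrobCharpolyAt v (X - C (ι⁻¹(‖ϖ_v‖)⁻¹))` (Serre 1968 Ch. I §1.2:
  `χ_ℓ` is unramified away from `ℓ` with `χ_ℓ(Frob_v) = N v`; tree:
  `FramedGaloisRep.isUnramifiedAt_cyclotomic_holds`,
  `GaloisRep.cyclotomicCharacter_apply_of_isArithFrobAt`).
* `FramedGaloisRep.exists_heckeCharacter_of_cyclotomic` — hence the conclusion of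
  `exists_heckeCharacter_of_weaklyDivides` holds for such `ψ`, with `χ = ‖·‖`;
  `FramedGaloisRep.exists_cyclotomic_padicAlgCl` — such a `ψ` exists (base change of the tree's
  `FramedGaloisRep.cyclotomic K ℓ : Γ_K →ₜ* GL_1(ℤ_ℓ)` along `ℤ_ℓ → ℚ_ℓ → ℚ̄_ℓ`).

* **Non-vacuity of the hypotheses of the fact** (appended 2026-08-15):
  `FramedGaloisRep.isSemisimple_toGaloisRep_of_rank_one` (rank-one representations are
  semisimple), `isUnramifiedAt_of_cyclotomic`, `hasFrobCharpolyAt_natCast_of_cyclotomic`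
  (`ι`-free forms of the place-by-place statement), `isRationalOver_rat_of_cyclotomic` (`χ_ℓ` is
  `ℚ`-rational: Frobenius polynomial `X - N v`), `weaklyDivides_self_of_eventually_isUnramifiedAt`,
  `not_isOfFinOrder_apply_of_cyclotomic`, `exists_heightOneSpectrum_natCast_not_mem`,
  `infinite_range_of_cyclotomic`, assembled in `exists_hypotheses_weaklyDivides_infinite_range`:
  for every number field `K` and prime `ℓ` the hypotheses of
  `exists_heckeCharacter_of_weaklyDivides` are met with `n = 1`, `E = ℚ`, `ρ = ψ = χ_ℓ` of INFINITE
  image — the instance `n = 1` of the fact is exactly "(E-rat) ⇒ (Loc-alg)" for characters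
  (BH §2.4, Serre–Waldschmidt–Henniart), so the fact is far from vacuous.

Nothing here uses the hypotheses of Theorem 1.1; the general fact remains a named fact (its
printed proof needs `ℓ`-adic transcendence, algebraic monodromy groups and Serre's theory of the
groups `S_𝔪`, see `WeakAbelianDirectSummandProofs.lean`).

## References

* G. Böckle, C.-Y. Hui, Math. Ann. 393 (2025), Thm. 1.1, §3.2.1. [BockleHui2025]
* J.-P. Serre, *Abelian ℓ-adic representations and elliptic curves* (1968), Ch. I §1.2 (Example:
  `χ_ℓ`), Ch. II §2.3–2.4 (algebraic Hecke characters; `‖·‖`). [SerreAbelianLadic1968]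
* J. Tate, *Fourier analysis in number fields …* (1950), in Cassels–Fröhlich (1967), Ch. XV,
  §2.3, §4.3. [TateThesis1967]
* A. Weil, *On a certain type of characters of the idèle-class group of an algebraic
  number-field* (1956) (type `A₀`).
-/

noncomputable section

open scoped NumberField Matrix
open NumberField Field IsDedekindDomain Polynomial Filter

namespace Literature.NumberTheory.GaloisRepresentations

/-! ### The norm character is algebraic, unramified, with `‖ϖ_v‖ = (N v)⁻¹` -/

namespace HeckeCharacter

variable {K : Type} [Field K] [NumberField K]

/-- The idele norm of an infinite idele `(x, 1)` is its archimedean part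
`∏_{w ∣ ∞} ‖x_w‖^{[K_w : ℝ]}`. [folklore] -/
theorem ideleNorm_infiniteIdeles (x : (InfiniteAdeleRing K)ˣ) :
    ideleNorm (infiniteIdeles K x) =
      ∏ w : InfinitePlace K, ‖(x : InfiniteAdeleRing K) w‖ ^ w.mult := by
  unfold ideleNorm
  have h2 : ((infiniteIdeles K x : ideleGroup K) : AdeleRing (𝓞 K) K).2 = 1 := rfl
  have h1 :
      ((infiniteIdeles K x : ideleGroup K) : AdeleRing (𝓞 K) K).1 = (x : InfiniteAdeleRing K) :=
    rfl
  have h3 : ∀ v : HeightOneSpectrum (𝓞 K), (1 : FiniteAdeleRing (𝓞 K) K) v = 1 := fun v => rfl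
  rw [h2, h1, finprod_eq_one_of_forall_eq_one fun v => by rw [h3 v, norm_one], mul_one]

/-- **The norm character is algebraic** (of type `A₀`): with `p_w = -1` for every infinite place
`w`, `q_w = 0` for real and `q_w = -1` for complex `w`, one has, for every infinite idele `x` whose
real coordinates are positive (an open neighbourhood of `1`),
`‖(x, 1)‖ = ∏_w ‖x_w‖^{[K_w:ℝ]} = ∏_{w real} ι_w(x_w) · ∏_{w complex} ι_w(x_w) \overline{ι_w(x_w)}`
(`ι_w = extensionEmbedding w` is an isometry, real-valued at real `w`).
Ref: Weil (1956) (`‖·‖` is of type `A₀`); Serre, *Abelian ℓ-adic representations* (1968), Ch. II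
§2.3 (the character attached to the norm). [cite: SerreAbelianLadic1968, Ch. II §2.3] -/
theorem isAlgebraic_normCharacter : (normCharacter K).IsAlgebraic := by
  classical
  -- notation: the complex coordinate of `x` at `w`
  set E : InfinitePlace K → (InfiniteAdeleRing K)ˣ → ℂ := fun w x =>
    InfinitePlace.Completion.extensionEmbedding w ((x : InfiniteAdeleRing K) w) with hE
  have hEcont : ∀ w, Continuous (E w) := fun w =>
    (InfinitePlace.Completion.isometry_extensionEmbedding w).continuous.comp
      ((continuous_apply w).comp Units.continuous_val)
  have hEnorm : ∀ w x, ‖E w x‖ = ‖(x : InfiniteAdeleRing K) w‖ := fun w x =>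
    (InfinitePlace.Completion.isometry_extensionEmbedding w).norm_map_of_map_zero (map_zero _) _
  -- the neighbourhood: positive real coordinates
  set U : Set (InfiniteAdeleRing K)ˣ := {x | ∀ w : InfinitePlace K, w.IsReal → 0 < (E w x).re}
    with hU
  have hUopen : IsOpen U := by
    have : U = ⋂ w : InfinitePlace K, {x | w.IsReal → 0 < (E w x).re} := by
      ext x; simp [hU]
    rw [this]
    refine isOpen_iInter_of_finite fun w => ?_
    by_cases hw : w.IsReal
    · have : {x : (InfiniteAdeleRing K)ˣ | w.IsReal → 0 < (E w x).re} =
          (fun x => (E w x).re) ⁻¹' Set.Ioi 0 := by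
        ext x; simp [hw]
      rw [this]
      exact isOpen_Ioi.preimage (Complex.continuous_re.comp (hEcont w))
    · have : {x : (InfiniteAdeleRing K)ˣ | w.IsReal → 0 < (E w x).re} = Set.univ := by
        ext x; simp [hw]
      rw [this]
      exact isOpen_univ
  have hUone : (1 : (InfiniteAdeleRing K)ˣ) ∈ U := fun w _ => by
    simp only [hE, Units.val_one]
    rw [show (1 : InfiniteAdeleRing K) w = 1 from rfl, map_one, Complex.one_re]
    exact one_pos
  refine ⟨fun _ => -1, fun w => if w.IsReal then 0 else -1, U, hUopen.mem_nhds hUone,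
    fun x hx => ?_⟩
  rw [normCharacter_apply, ideleNorm_infiniteIdeles, Complex.ofReal_prod]
  refine Finset.prod_congr rfl fun w _ => ?_
  change ((‖(x : InfiniteAdeleRing K) w‖ ^ w.mult : ℝ) : ℂ) =
    E w x ^ (-(-1 : ℤ)) * (starRingEnd ℂ) (E w x) ^ (-(if w.IsReal then (0 : ℤ) else -1))
  rw [Complex.ofReal_pow, ← hEnorm w x, neg_neg, zpow_one]
  by_cases hw : w.IsReal
  · -- real place: `E w x` is a positive real number
    rw [NumberField.InfinitePlace.mult, if_pos hw, if_pos hw, neg_zero, zpow_zero, mul_one,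
      pow_one]
    have hreal : ((InfinitePlace.Completion.extensionEmbeddingOfIsReal hw
        ((x : InfiniteAdeleRing K) w) : ℝ) : ℂ) = E w x :=
      InfinitePlace.Completion.extensionEmbeddingOfIsReal_apply hw _
    have hpos : 0 < (E w x).re := hx w hw
    rw [← hreal] at hpos ⊢
    rw [Complex.ofReal_re] at hpos
    rw [Complex.norm_real, Real.norm_eq_abs, abs_of_pos hpos]
  · -- complex place: `|z|² = z \bar z`
    rw [NumberField.InfinitePlace.mult, if_neg hw, if_neg hw, neg_neg, zpow_one,
      Complex.mul_conj']

/-- The norm character is unramified at every finite place (the idele norm is trivial on `𝒪_vˣ`;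
the tree's `IsNormTwist.isUnramifiedAt_holds` with `isNormTwist_normCharacter`).
Ref: Tate (1950), §2.3, Lemma 2.3.1. [cite: TateThesis1967, Lemma 2.3.1] -/
theorem isUnramifiedAt_normCharacter (v : HeightOneSpectrum (𝓞 K)) :
    (normCharacter K).IsUnramifiedAt v :=
  IsNormTwist.isUnramifiedAt_holds (isNormTwist_normCharacter K) v

/-- **`‖ϖ_v‖ = (N v)⁻¹`**: the value of the norm character at (the uniformizer idele of) `v` is
the inverse of the residue cardinality `N v = v.residueCard` (`ideleNorm_localUnits`,
`norm_uniformizer`).  Ref: Tate (1950), §4.3 (`|π| = Np⁻¹`). [cite: TateThesis1967, §4.3] -/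
theorem valueAtUniformizer_normCharacter (v : HeightOneSpectrum (𝓞 K)) :
    (normCharacter K).valueAtUniformizer v = ((v.residueCard : ℂ))⁻¹ := by
  rw [valueAtUniformizer, localComponent_apply, normCharacter_apply, ideleNorm_localUnits,
    norm_uniformizer, Complex.ofReal_inv, Complex.ofReal_natCast]
  rfl

end HeckeCharacter

/-! ### The cyclotomic character satisfies the conclusion of Theorem 1.1 with `χ = ‖·‖` -/

namespace FramedGaloisRep

variable {K : Type} [Field K] [NumberField K] {ℓ : ℕ} [Fact ℓ.Prime]

/-- A `1 × 1` invertible matrix is determined by its entry. [folklore] -/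
theorem gl_one_eq_one_of_apply_eq_one {A : Type*} [CommRing A] {g : GL (Fin 1) A}
    (h : (g : Matrix (Fin 1) (Fin 1) A) 0 0 = 1) : g = 1 :=
  Units.ext (Matrix.ext fun i j => by
    rw [Subsingleton.elim i 0, Subsingleton.elim j 0, h]; rfl)

/-- The set of finite places of `K` above `ℓ` is finite, so `ℓ ∉ v` for all but finitely many
`v`. [folklore] -/
theorem eventually_natCast_not_mem (K : Type) [Field K] [NumberField K] (ℓ : ℕ) [Fact ℓ.Prime] :
    ∀ᶠ v : HeightOneSpectrum (𝓞 K) in cofinite, (ℓ : 𝓞 K) ∉ v.asIdeal := by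
  have hℓ : (Ideal.span {(ℓ : 𝓞 K)} : Ideal (𝓞 K)) ≠ ⊥ := by
    rw [Ne, Ideal.span_singleton_eq_bot, Nat.cast_eq_zero]
    exact (Fact.out : ℓ.Prime).ne_zero
  rw [Filter.eventually_cofinite]
  refine (Ideal.finite_factors hℓ).subset fun v hv => ?_
  simp only [Set.mem_setOf_eq, not_not] at hv ⊢
  exact (Ideal.dvd_span_singleton).mpr hv

/-- **The cyclotomic character against the norm character, place by place.**  Let
`ψ : Γ_K →ₜ* GL_1(ℚ̄_ℓ)` be a rank-one representation whose entry is the `ℓ`-adic cyclotomic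
character, `(ψ σ)₀₀ = χ_ℓ(σ)` (through `ℤ_ℓ → ℚ_ℓ → ℚ̄_ℓ`), and `ι : ℚ̄_ℓ ≃+* ℂ`.  Then at every
finite place `v ∤ ℓ`, `ψ` is unramified (`χ_ℓ` is, Serre I §1.2; tree
`FramedGaloisRep.isUnramifiedAt_cyclotomic_holds`) and, since `χ_ℓ(Frob_v) = N v`
(`GaloisRep.cyclotomicCharacter_apply_of_isArithFrobAt`) and `‖ϖ_v‖ = (N v)⁻¹`
(`HeckeCharacter.valueAtUniformizer_normCharacter`), `ψ(Frob_v) = ι⁻¹(‖ϖ_v‖)⁻¹`, i.e.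
`ψ.HasFrobCharpolyAt v (X - C (ι⁻¹(‖ϖ_v‖)⁻¹))` — the normalisation of
`exists_heckeCharacter_of_weaklyDivides` with `χ = ‖·‖`.
[cite: SerreAbelianLadic1968, Ch. I §1.2 (Example: the cyclotomic character)] -/
theorem hasFrobCharpolyAt_normCharacter_of_cyclotomic (ψ : FramedGaloisRep K (PadicAlgCl ℓ) 1)
    (hψ : ∀ σ : absoluteGaloisGroup K,
      ((ψ σ : GL (Fin 1) (PadicAlgCl ℓ)) : Matrix (Fin 1) (Fin 1) (PadicAlgCl ℓ)) 0 0 =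
        algebraMap ℚ_[ℓ] (PadicAlgCl ℓ)
          (((GaloisRep.cyclotomicCharacter K ℓ σ : ℤ_[ℓ]ˣ) : ℤ_[ℓ]) : ℚ_[ℓ]))
    (ι : PadicAlgCl ℓ ≃+* ℂ) {v : HeightOneSpectrum (𝓞 K)} (hv : (ℓ : 𝓞 K) ∉ v.asIdeal) :
    ψ.IsUnramifiedAt v ∧
      ψ.HasFrobCharpolyAt v
        (X - C (ι.symm ((HeckeCharacter.normCharacter K).valueAtUniformizer v)⁻¹)) := by
  constructor
  · intro 𝔓 h𝔓 σ hσ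
    have h1 : FramedGaloisRep.cyclotomic K ℓ σ = 1 :=
      FramedGaloisRep.isUnramifiedAt_cyclotomic_holds K ℓ hv 𝔓 h𝔓 σ hσ
    have h2 : ((GaloisRep.cyclotomicCharacter K ℓ σ : ℤ_[ℓ]ˣ) : ℤ_[ℓ]) = 1 := by
      have := congrArg (fun g : GL (Fin 1) ℤ_[ℓ] => (g : Matrix (Fin 1) (Fin 1) ℤ_[ℓ]) 0 0) h1
      simpa [FramedGaloisRep.cyclotomic] using this
    refine gl_one_eq_one_of_apply_eq_one ?_
    rw [hψ σ, h2, PadicInt.coe_one, map_one]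
  · refine (hasFrobCharpolyAt_iff_of_rank_one ψ v _).mpr fun 𝔓 h𝔓 Φ hΦ => ?_
    rw [hψ Φ, GaloisRep.cyclotomicCharacter_apply_of_isArithFrobAt hv h𝔓 hΦ,
      HeckeCharacter.valueAtUniformizer_normCharacter, inv_inv, map_natCast, PadicInt.coe_natCast,
      map_natCast]

/-- **The conclusion of Böckle–Hui's Theorem 1.1 (as `exists_heckeCharacter_of_weaklyDivides`)
holds for the `ℓ`-adic cyclotomic character, witnessed by the norm character `χ = ‖·‖`**: for
`ψ : Γ_K →ₜ* GL_1(ℚ̄_ℓ)` with entry `χ_ℓ` and every `ι : ℚ̄_ℓ ≃+* ℂ`, the Hecke character `‖·‖`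
is algebraic (`HeckeCharacter.isAlgebraic_normCharacter`) and at all but finitely many `v`
(those with `v ∤ ℓ`), `‖·‖` and `ψ` are unramified and
`ψ.HasFrobCharpolyAt v (X - C (ι⁻¹(‖ϖ_v‖)⁻¹))`.  This certifies the sign conventions of the
named fact on the basic infinite-order example (module docstring of
`WeakAbelianDirectSummand.lean`: "`χ_ℓ ↔ ‖·‖`"); with the opposite convention `χ(ϖ_v)` in place
of `χ(ϖ_v)⁻¹` the witness would be `‖·‖⁻¹`, equally algebraic.
[cite: BockleHui2025, Theorem 1.1 and §3.2.1] -/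
theorem exists_heckeCharacter_of_cyclotomic (ψ : FramedGaloisRep K (PadicAlgCl ℓ) 1)
    (hψ : ∀ σ : absoluteGaloisGroup K,
      ((ψ σ : GL (Fin 1) (PadicAlgCl ℓ)) : Matrix (Fin 1) (Fin 1) (PadicAlgCl ℓ)) 0 0 =
        algebraMap ℚ_[ℓ] (PadicAlgCl ℓ)
          (((GaloisRep.cyclotomicCharacter K ℓ σ : ℤ_[ℓ]ˣ) : ℤ_[ℓ]) : ℚ_[ℓ]))
    (ι : PadicAlgCl ℓ ≃+* ℂ) :
    ∃ χ : HeckeCharacter K, χ.IsAlgebraic ∧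
      ∀ᶠ v : HeightOneSpectrum (𝓞 K) in cofinite, χ.IsUnramifiedAt v ∧ ψ.IsUnramifiedAt v ∧
        ψ.HasFrobCharpolyAt v (X - C (ι.symm (χ.valueAtUniformizer v)⁻¹)) :=
  ⟨HeckeCharacter.normCharacter K, HeckeCharacter.isAlgebraic_normCharacter,
    (eventually_natCast_not_mem K ℓ).mono fun v hv =>
      ⟨HeckeCharacter.isUnramifiedAt_normCharacter v,
        ψ.hasFrobCharpolyAt_normCharacter_of_cyclotomic hψ ι hv⟩⟩

/-- **Existence of the `ℚ̄_ℓ`-valued cyclotomic character**: there is a rank-one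
`ψ : Γ_K →ₜ* GL_1(ℚ̄_ℓ)` with entry `χ_ℓ` — the base change of the tree's
`FramedGaloisRep.cyclotomic K ℓ : Γ_K →ₜ* GL_1(ℤ_ℓ)` along the continuous ring map
`ℤ_ℓ → ℚ_ℓ → ℚ̄_ℓ` (`FramedRep.baseChange`).  So `exists_heckeCharacter_of_cyclotomic` is not
vacuous.  Ref: Serre (1968), Ch. I §1.2. [folklore] -/
theorem exists_cyclotomic_padicAlgCl (K : Type) [Field K] [NumberField K] (ℓ : ℕ) [Fact ℓ.Prime] :
    ∃ ψ : FramedGaloisRep K (PadicAlgCl ℓ) 1, ∀ σ : absoluteGaloisGroup K,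
      ((ψ σ : GL (Fin 1) (PadicAlgCl ℓ)) : Matrix (Fin 1) (Fin 1) (PadicAlgCl ℓ)) 0 0 =
        algebraMap ℚ_[ℓ] (PadicAlgCl ℓ)
          (((GaloisRep.cyclotomicCharacter K ℓ σ : ℤ_[ℓ]ˣ) : ℤ_[ℓ]) : ℚ_[ℓ]) := by
  set f : ℤ_[ℓ] →+* PadicAlgCl ℓ := (algebraMap ℚ_[ℓ] (PadicAlgCl ℓ)).comp PadicInt.Coe.ringHom
    with hf
  have hfc : Continuous f :=
    (continuous_algebraMap ℚ_[ℓ] (PadicAlgCl ℓ)).comp continuous_subtype_val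
  refine ⟨FramedRep.baseChange f hfc (FramedGaloisRep.cyclotomic K ℓ), fun σ => ?_⟩
  rw [FramedRep.baseChange_apply, Matrix.GeneralLinearGroup.map_apply]
  simp [FramedGaloisRep.cyclotomic, hf]

end FramedGaloisRep

/-! ### Non-vacuity of the hypotheses of Theorem 1.1: `ρ = ψ = χ_ℓ`, `E = ℚ`, `n = 1` -/

namespace FramedGaloisRep

variable {K : Type} [Field K] [NumberField K] {ℓ : ℕ} [Fact ℓ.Prime]

/-- **A rank-one representation over a field is semisimple** (it is irreducible: its only
subrepresentations are `⊥` and `⊤`, the only subspaces of a line; an irreducible representation is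
semisimple).  In particular the hypothesis `ρ.toGaloisRep.IsSemisimple` of
`exists_heckeCharacter_of_weaklyDivides` holds for every `ρ` of rank one. [folklore] -/
theorem isSemisimple_toGaloisRep_of_rank_one {F : Type*} [Field F] {A : Type*} [Field A]
    [TopologicalSpace A] [IsTopologicalRing A] (ψ : FramedGaloisRep F A 1) :
    ψ.toGaloisRep.IsSemisimple := by
  set τ := ψ.toGaloisRep.toRepresentation with hτ
  have h1 : Module.finrank A (Fin 1 → A) = 1 := Module.finrank_fin_fun A
  haveI hs : IsSimpleModule A (Fin 1 → A) := isSimpleModule_iff_finrank_eq_one.2 h1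
  have hinj := Subrepresentation.toSubmodule_injective (ρ := τ)
  have hbot : (⊥ : Subrepresentation τ).toSubmodule = ⊥ := rfl
  have htop : (⊤ : Subrepresentation τ).toSubmodule = ⊤ := rfl
  haveI : Nontrivial (Subrepresentation τ) := ⟨⟨⊥, ⊤, fun e => by
    have := congrArg Subrepresentation.toSubmodule e
    rw [hbot, htop] at this
    exact bot_ne_top this⟩⟩
  haveI : τ.IsIrreducible := ⟨fun U => by
    rcases eq_bot_or_eq_top U.toSubmodule with hU | hU
    · exact Or.inl (hinj (hU.trans hbot.symm))
    · exact Or.inr (hinj (hU.trans htop.symm))⟩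
  change τ.IsSemisimpleRepresentation
  infer_instance

/-- A representation unramified at all but finitely many places weakly divides itself (the
trivial case of BH §1.1: "Abelian direct summands (i.e., subrepresentations) of `ρ_ℓ` are obvious
examples of weak abelian direct summands"). [cite: BockleHui2025, §1.1] -/
theorem weaklyDivides_self_of_eventually_isUnramifiedAt {A : Type*} [CommRing A]
    [TopologicalSpace A] {n : ℕ} {ρ : FramedGaloisRep K A n}
    (h : ∀ᶠ v : HeightOneSpectrum (𝓞 K) in cofinite, ρ.IsUnramifiedAt v) : ρ.WeaklyDivides ρ :=
  WeaklyDivides.of_eventually (h.mono fun _ hv => ⟨hv, hv, fun _ _ _ _ => dvd_rfl⟩)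

/-- `χ_ℓ` over `ℚ̄_ℓ` is unramified at every `v ∤ ℓ` (`ι`-free form of the first half of
`hasFrobCharpolyAt_normCharacter_of_cyclotomic`; Serre I §1.2, tree
`FramedGaloisRep.isUnramifiedAt_cyclotomic_holds`).
[cite: SerreAbelianLadic1968, Ch. I §1.2 (Example: the cyclotomic character)] -/
theorem isUnramifiedAt_of_cyclotomic (ψ : FramedGaloisRep K (PadicAlgCl ℓ) 1)
    (hψ : ∀ σ : absoluteGaloisGroup K,
      ((ψ σ : GL (Fin 1) (PadicAlgCl ℓ)) : Matrix (Fin 1) (Fin 1) (PadicAlgCl ℓ)) 0 0 =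
        algebraMap ℚ_[ℓ] (PadicAlgCl ℓ)
          (((GaloisRep.cyclotomicCharacter K ℓ σ : ℤ_[ℓ]ˣ) : ℤ_[ℓ]) : ℚ_[ℓ]))
    {v : HeightOneSpectrum (𝓞 K)} (hv : (ℓ : 𝓞 K) ∉ v.asIdeal) : ψ.IsUnramifiedAt v := by
  intro 𝔓 h𝔓 σ hσ
  have h1 : FramedGaloisRep.cyclotomic K ℓ σ = 1 :=
    FramedGaloisRep.isUnramifiedAt_cyclotomic_holds K ℓ hv 𝔓 h𝔓 σ hσ
  have h2 : ((GaloisRep.cyclotomicCharacter K ℓ σ : ℤ_[ℓ]ˣ) : ℤ_[ℓ]) = 1 := by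
    have := congrArg (fun g : GL (Fin 1) ℤ_[ℓ] => (g : Matrix (Fin 1) (Fin 1) ℤ_[ℓ]) 0 0) h1
    simpa [FramedGaloisRep.cyclotomic] using this
  refine gl_one_eq_one_of_apply_eq_one ?_
  rw [hψ σ, h2, PadicInt.coe_one, map_one]

/-- `χ_ℓ(Frob_v) = N v` over `ℚ̄_ℓ` (`ι`-free form): `ψ.HasFrobCharpolyAt v (X - C (N v))` at every
`v ∤ ℓ` (tree `GaloisRep.cyclotomicCharacter_apply_of_isArithFrobAt`).
[cite: SerreAbelianLadic1968, Ch. I §1.2 (Example: the cyclotomic character)] -/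
theorem hasFrobCharpolyAt_natCast_of_cyclotomic (ψ : FramedGaloisRep K (PadicAlgCl ℓ) 1)
    (hψ : ∀ σ : absoluteGaloisGroup K,
      ((ψ σ : GL (Fin 1) (PadicAlgCl ℓ)) : Matrix (Fin 1) (Fin 1) (PadicAlgCl ℓ)) 0 0 =
        algebraMap ℚ_[ℓ] (PadicAlgCl ℓ)
          (((GaloisRep.cyclotomicCharacter K ℓ σ : ℤ_[ℓ]ˣ) : ℤ_[ℓ]) : ℚ_[ℓ]))
    {v : HeightOneSpectrum (𝓞 K)} (hv : (ℓ : 𝓞 K) ∉ v.asIdeal) :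
    ψ.HasFrobCharpolyAt v (X - C (v.residueCard : PadicAlgCl ℓ)) := by
  refine (hasFrobCharpolyAt_iff_of_rank_one ψ v _).mpr fun 𝔓 h𝔓 Φ hΦ => ?_
  rw [hψ Φ, GaloisRep.cyclotomicCharacter_apply_of_isArithFrobAt hv h𝔓 hΦ, PadicInt.coe_natCast,
    map_natCast]

/-- **`χ_ℓ` is `ℚ`-rational**: at every `v ∤ ℓ` it is unramified with Frobenius characteristic
polynomial `X - N v`, the image of `X - N v ∈ ℚ[X]` along `ℚ → ℚ̄_ℓ` (Serre I §2.3: the basic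
example of a rational `ℓ`-adic representation; BH §2.1).
[cite: SerreAbelianLadic1968, Ch. I §2.3] -/
theorem isRationalOver_rat_of_cyclotomic (ψ : FramedGaloisRep K (PadicAlgCl ℓ) 1)
    (hψ : ∀ σ : absoluteGaloisGroup K,
      ((ψ σ : GL (Fin 1) (PadicAlgCl ℓ)) : Matrix (Fin 1) (Fin 1) (PadicAlgCl ℓ)) 0 0 =
        algebraMap ℚ_[ℓ] (PadicAlgCl ℓ)
          (((GaloisRep.cyclotomicCharacter K ℓ σ : ℤ_[ℓ]ˣ) : ℤ_[ℓ]) : ℚ_[ℓ])) :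
    ψ.IsRationalOver (algebraMap ℚ (PadicAlgCl ℓ)) :=
  (eventually_natCast_not_mem K ℓ).mono fun v hv =>
    ⟨ψ.isUnramifiedAt_of_cyclotomic hψ hv, X - C (v.residueCard : ℚ), by
      rw [Polynomial.map_sub, Polynomial.map_X, Polynomial.map_C, map_natCast]
      exact ψ.hasFrobCharpolyAt_natCast_of_cyclotomic hψ hv⟩

/-- `ψ(Frob_v)` has infinite order for `ψ` with entry `χ_ℓ` and `v ∤ ℓ` (its determinant is
`χ_ℓ(Frob_v) = N v`, of infinite order by `GaloisRep.cyclotomicCharacter_frob_not_isOfFinOrder`).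
[folklore] -/
theorem not_isOfFinOrder_apply_of_cyclotomic (ψ : FramedGaloisRep K (PadicAlgCl ℓ) 1)
    (hψ : ∀ σ : absoluteGaloisGroup K,
      ((ψ σ : GL (Fin 1) (PadicAlgCl ℓ)) : Matrix (Fin 1) (Fin 1) (PadicAlgCl ℓ)) 0 0 =
        algebraMap ℚ_[ℓ] (PadicAlgCl ℓ)
          (((GaloisRep.cyclotomicCharacter K ℓ σ : ℤ_[ℓ]ˣ) : ℤ_[ℓ]) : ℚ_[ℓ]))
    {v : HeightOneSpectrum (𝓞 K)} (hv : (ℓ : 𝓞 K) ∉ v.asIdeal)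
    {𝔓 : Ideal (absIntegers (𝓞 K) K)} (h𝔓 : 𝔓 ∈ v.primesAbove)
    {σ : absoluteGaloisGroup K} (hσ : IsArithFrobAt (𝓞 K) σ 𝔓) : ¬ IsOfFinOrder (ψ σ) := by
  intro hfin
  apply GaloisRep.cyclotomicCharacter_frob_not_isOfFinOrder (ℓ := ℓ) hv h𝔓 hσ
  obtain ⟨m, hm, hpow⟩ := hfin.exists_pow_eq_one
  refine isOfFinOrder_iff_pow_eq_one.mpr ⟨m, hm, ?_⟩
  -- pass to the determinant, i.e. the entry, of the `1 × 1` matrix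
  have h := congrArg (fun g : GL (Fin 1) (PadicAlgCl ℓ) =>
    ((Matrix.GeneralLinearGroup.det g : (PadicAlgCl ℓ)ˣ) : PadicAlgCl ℓ)) hpow
  simp only [map_pow, map_one, Units.val_pow_eq_pow_val, Units.val_one,
    Matrix.GeneralLinearGroup.val_det_apply, Matrix.det_fin_one] at h
  rw [hψ σ, ← map_pow, ← (algebraMap ℚ_[ℓ] (PadicAlgCl ℓ)).map_one] at h
  have h' := (algebraMap ℚ_[ℓ] (PadicAlgCl ℓ)).injective h
  rw [← PadicInt.coe_pow, ← PadicInt.coe_one] at h'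
  have h'' : ((GaloisRep.cyclotomicCharacter K ℓ σ : ℤ_[ℓ]ˣ) : ℤ_[ℓ]) ^ m = 1 := PadicInt.ext h'
  exact Units.ext (by rw [Units.val_pow_eq_pow_val, h'', Units.val_one])

omit [Fact ℓ.Prime] in
/-- There is a finite place `v ∤ ℓ` of `K` (`ℓ ≠ 0`): a prime of `𝓞 K` above a rational prime
`p > ℓ`
(going up for the integral extension `ℤ ⊆ 𝓞 K`). [folklore] -/
theorem exists_heightOneSpectrum_natCast_not_mem (K : Type) [Field K] [NumberField K] {ℓ : ℕ}
    (hℓ : ℓ ≠ 0) : ∃ v : HeightOneSpectrum (𝓞 K), (ℓ : 𝓞 K) ∉ v.asIdeal := by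
  obtain ⟨p, hpgt, hp⟩ := Nat.exists_infinite_primes (ℓ + 1)
  have hpℓ : ¬ p ∣ ℓ := fun h => absurd (Nat.le_of_dvd (Nat.pos_of_ne_zero hℓ) h) (by omega)
  set 𝔭 : Ideal ℤ := Ideal.span {(p : ℤ)} with h𝔭
  have hp' : Prime (p : ℤ) := Nat.prime_iff_prime_int.mp hp
  haveI h𝔭p : 𝔭.IsPrime := (Ideal.span_singleton_prime hp'.ne_zero).mpr hp'
  have h𝔭0 : 𝔭 ≠ ⊥ := by
    rw [Ne, Ideal.span_singleton_eq_bot]; exact hp'.ne_zero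
  haveI : 𝔭.IsMaximal := h𝔭p.isMaximal h𝔭0
  obtain ⟨P, hPmax, hP⟩ := Ideal.exists_ideal_over_maximal_of_isIntegral (S := 𝓞 K) 𝔭
    (by rw [(RingHom.injective_iff_ker_eq_bot _).mp (algebraMap ℤ (𝓞 K)).injective_int]
        exact bot_le)
  have hP0 : P ≠ ⊥ := by
    rintro rfl
    apply h𝔭0
    rw [← hP, Ideal.comap_bot_of_injective _ (algebraMap ℤ (𝓞 K)).injective_int]
  refine ⟨⟨P, hPmax.isPrime, hP0⟩, fun hℓ => hpℓ ?_⟩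
  have : ((ℓ : ℤ) : ℤ) ∈ 𝔭 := by
    rw [← hP, Ideal.mem_comap, map_natCast]
    exact hℓ
  rw [h𝔭, Ideal.mem_span_singleton] at this
  exact Int.natCast_dvd_natCast.mp this

/-- **`χ_ℓ` has infinite image**: for `ψ` with entry `χ_ℓ`, `Set.range ψ` is infinite (the
powers of `ψ(Frob_v)`, `v ∤ ℓ`, are pairwise distinct; Frobenius elements exist by the tree's
`HeightOneSpectrum.exists_isArithFrobAt_of_mem_primesAbove_holds`). [folklore] -/
theorem infinite_range_of_cyclotomic (ψ : FramedGaloisRep K (PadicAlgCl ℓ) 1)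
    (hψ : ∀ σ : absoluteGaloisGroup K,
      ((ψ σ : GL (Fin 1) (PadicAlgCl ℓ)) : Matrix (Fin 1) (Fin 1) (PadicAlgCl ℓ)) 0 0 =
        algebraMap ℚ_[ℓ] (PadicAlgCl ℓ)
          (((GaloisRep.cyclotomicCharacter K ℓ σ : ℤ_[ℓ]ˣ) : ℤ_[ℓ]) : ℚ_[ℓ])) :
    (Set.range ψ).Infinite := by
  obtain ⟨v, hv⟩ := exists_heightOneSpectrum_natCast_not_mem K (Fact.out : ℓ.Prime).ne_zero
  obtain ⟨𝔓, h𝔓⟩ := v.primesAbove_nonempty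
  obtain ⟨σ, hσ⟩ := HeightOneSpectrum.exists_isArithFrobAt_of_mem_primesAbove_holds h𝔓
  have hinj : Function.Injective fun n : ℕ => ψ σ ^ n :=
    injective_pow_iff_not_isOfFinOrder.mpr (ψ.not_isOfFinOrder_apply_of_cyclotomic hψ hv h𝔓 hσ)
  refine Set.infinite_of_injective_forall_mem hinj fun n => ?_
  exact ⟨σ ^ n, (map_pow ψ σ n)⟩

/-- **The hypotheses of `exists_heckeCharacter_of_weaklyDivides` are satisfied non-trivially**:
for every number field `K` and prime `ℓ` there is a rank-one `ρ : Γ_K →ₜ* GL_1(ℚ̄_ℓ)` (namely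
`χ_ℓ`, `exists_cyclotomic_padicAlgCl`) which is semisimple, `ℚ`-rational
(`E = ℚ`, `e = algebraMap ℚ ℚ̄_ℓ`), weakly divides itself, and has INFINITE image.  For such data
(`n = 1`, `ψ = ρ`) the fact asserts that an `E`-rational `ℓ`-adic character comes from an
algebraic Hecke character — the implication "(E-rat) ⇒ (Loc-alg)" of BH §2.4
(Serre–Waldschmidt–Henniart), here indeed witnessed by `χ = ‖·‖`
(`exists_heckeCharacter_of_cyclotomic`). [cite: BockleHui2025, §2.4 and Theorem 1.1] -/
theorem exists_hypotheses_weaklyDivides_of_infinite_range (K : Type) [Field K] [NumberField K]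
    (ℓ : ℕ) [Fact ℓ.Prime] :
    ∃ ρ : FramedGaloisRep K (PadicAlgCl ℓ) 1, ρ.toGaloisRep.IsSemisimple ∧
      ρ.IsRationalOver (algebraMap ℚ (PadicAlgCl ℓ)) ∧ ρ.WeaklyDivides ρ ∧
      (Set.range ρ).Infinite := by
  obtain ⟨ρ, hρ⟩ := exists_cyclotomic_padicAlgCl K ℓ
  exact ⟨ρ, ρ.isSemisimple_toGaloisRep_of_rank_one, ρ.isRationalOver_rat_of_cyclotomic hρ,
    weaklyDivides_self_of_eventually_isUnramifiedAt
      ((eventually_natCast_not_mem K ℓ).mono fun v hv => ρ.isUnramifiedAt_of_cyclotomic hρ hv),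
    ρ.infinite_range_of_cyclotomic hρ⟩

end FramedGaloisRep

end Literature.NumberTheory.GaloisRepresentations
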